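import Summits.BirchSwinnertonDyer.BirchSwinnertonDyer.Theorems.PrintCf2RamifiedOffTYZPartnerShaSelmerR1Local
import HarnessLib

/-!
# Crux `PrintCf2.RamifiedOffTYZOfFacts` (stmt-BirchSwinnertonDyer-20509), line `offtyz-v7`, LEAD cycle 24 (cruxlead-20509 g23), part 3/4:
# THE `φ`-SELMER GROUP ON R1 — `S(0, 4l²m²) = {1, l, m, lm}` EXACTLY, `dim S' = 2` (`n = lm`, `l ≡ 1`, `m ≡ 5 (mod 8)`, `(l/m) = +1`)

THEOREMS ONLY (no `def`, no named fact, no `sorry`), `--supports stmt-BirchSwinnertonDyer-20509`.  Assembly of part 2's local tools: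
`eq_of_squarefree_dvd_R1` (positive odd squarefree divisors of `4l²m²`), **`twoIsogenySelmerGroup'_R1` : `S(0, 4l²m²) = {1, l, m, lm}`** (members
`1, l, m` by part 2, `lm` by the group law; a member is positive (real place) and ODD — the even classes `2d₁` die at `m`), and
**`twoIsogenySelmerRank'_R1` : `dim S'(0, −l²m²) = 2`**.  So R1 has the SAME «two-prime shape» `(dim S, dim S') = (3, 2)` as R2 (with a different
`φ`-Selmer group: `{1, l, m, lm}` instead of `{1, 2, l, 2l}`), and cycle 21's HEADLINE applies (part 4).
Beyond-print theorem: NO (a routine `2`-isogeny descent).  BSD is not proved by any of this; C⁺ (23431) and the crux stay OPEN.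

References: [cite: SilvermanAEC2009, Prop. X.4.9, Example X.4.10, Prop. X.6.2(b)]; [cite: SilvermanTate2015, §3.6]; [cite: TianYuanZhang2017, §1 (A_n, φ_n)];
tree: parts 1–2 (`…PartnerShaSelmerR1{,Local}`), cycle 21 parts 4–6 (`…PartnerSha{DiagonalQuartics,SelmerR2,SelmerR2Prime}`).
-/

noncomputable section

open scoped Classical

open WeierstrassCurve Literature.NumberTheory Literature.NumberTheory.EllipticCurves Literature.NumberTheory.DiophantineGeometry
  Literature.NumberTheory.DiophantineGeometry.LindMordellQuartics Literature.NumberTheory.EllipticCurves.TianYuanZhang2017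

namespace Summit.BirchSwinnertonDyer.PrintCf2.PartnerSha

/-- `b / d = d'` from `d · d' = b`. [folklore] -/
private theorem ediv_eq_of_mul_eq_left {b d d' : ℤ} (hd : d ≠ 0) (h : d * d' = b) : b / d = d' := by
  rw [← h, Int.mul_ediv_cancel_left _ hd]

/-! ## §14 (continued) `Sel^{(φ)}(E_{lm} → A_{lm})` on R1: `S(0, 4l²m²) = {1, l, m, lm}`, `dim S'(0, −l²m²) = 2` -/

section R1'

variable {l m : ℕ} [hlp : Fact l.Prime] [hmp : Fact m.Prime]

/-- Positive ODD squarefree divisors of `4l²m²` are `1, l, m, lm`. [folklore] -/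
theorem eq_of_squarefree_dvd_R1 (hlm_ne : l ≠ m) {d : ℤ} (hd0 : 0 < d) (hsq : Squarefree d) (hodd : ¬ (2 : ℤ) ∣ d)
    (hdvd : d ∣ 4 * (l : ℤ) ^ 2 * (m : ℤ) ^ 2) :
    d = 1 ∨ d = l ∨ d = m ∨ d = (l : ℤ) * m := by
  have hl := hlp.out
  have hm := hmp.out
  -- `d ∣ (2lm)²` squarefree ⟹ `d ∣ 2lm` ⟹ (odd) `d ∣ lm`
  have h1 : d ∣ (2 * (l : ℤ) * m) ^ 2 := by
    rw [show (2 * (l : ℤ) * m) ^ 2 = 4 * (l : ℤ) ^ 2 * (m : ℤ) ^ 2 by ring]; exact hdvd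
  rw [hsq.dvd_pow_iff_dvd two_ne_zero] at h1
  have hcop : IsCoprime d (2 : ℤ) := ((Prime.coprime_iff_not_dvd Int.prime_two).mpr hodd).symm
  have h2 : d ∣ (l : ℤ) * m := by
    have : d ∣ 2 * ((l : ℤ) * m) := by simpa [mul_assoc] using h1
    exact hcop.dvd_of_dvd_mul_left this
  -- pass to `ℕ`
  obtain ⟨e, rfl⟩ : ∃ e : ℕ, d = (e : ℤ) := ⟨d.natAbs, by rw [Int.natAbs_of_nonneg hd0.le]⟩
  have h3 : e ∣ l * m := by exact_mod_cast h2
  obtain ⟨a, b, ha, hb, rfl⟩ := Nat.dvd_mul.mp h3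
  rcases (Nat.dvd_prime hl).mp ha with rfl | rfl <;>
    rcases (Nat.dvd_prime hm).mp hb with rfl | rfl <;> simp

/-- **`Sel^{(φ)}(E_{lm} → A_{lm}) = {1, l, m, lm}` on R1** (the descent on the divisors of `a² − 4b = 4l²m²`): `1, l, m` lie in it
(`isLocallySoluble_l_class_R1`, `isLocallySoluble_m_class_R1`) and so does `lm` (group law); a member is positive (real place) and ODD —
the even classes `2d₁` (`d₁ ∈ {1, l, m, lm}`) die at `m`: `2, 2l` by `not_isSoluble_padic_diag_of_sq_mul` (`2`, `2l` and `2l²` are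
non-residues mod `m ≡ 5 (8)`), `2m, 2lm` by `not_isSoluble_padic_diag_of_dvd_both_of_forall` (`−l²`, `−1` are not fourth powers mod
`m ≡ 5 (8)`) — hence one of `1, l, m, lm`. [cite: SilvermanAEC2009, Prop. X.4.9, Example X.4.10] [cite: TianYuanZhang2017, §1 (A_n)] -/
theorem twoIsogenySelmerGroup'_R1 (hl8 : l % 8 = 1) (hm8 : m % 8 = 5)
    (hlm : IsSquare ((l : ℤ) : ZMod m)) (hml : IsSquare ((m : ℤ) : ZMod l)) :
    twoIsogenySelmerGroup 0 (4 * (l : ℤ) ^ 2 * (m : ℤ) ^ 2) = {1, (l : ℤ), (m : ℤ), (l : ℤ) * m} := by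
  have hl := hlp.out
  have hm := hmp.out
  have hlm_ne : l ≠ m := by rintro rfl; omega
  have hl2 : l ≠ 2 := by rintro rfl; omega
  have hm2 : m ≠ 2 := by rintro rfl; omega
  have hl0 : (l : ℤ) ≠ 0 := by exact_mod_cast hl.ne_zero
  have hm0 : (m : ℤ) ≠ 0 := by exact_mod_cast hm.ne_zero
  set B : ℤ := 4 * (l : ℤ) ^ 2 * (m : ℤ) ^ 2 with hBdef
  have hBpos : 0 < B := by positivity
  have hB : B ≠ 0 := hBpos.ne'
  have hab : B * ((0 : ℤ) ^ 2 - 4 * B) ≠ 0 := by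
    have : (0 : ℤ) ^ 2 - 4 * B = -(4 * B) := by ring
    rw [this]; exact mul_ne_zero hB (neg_ne_zero.mpr (by positivity))
  have hsql : Squarefree (l : ℤ) := Int.squarefree_natCast.mpr hl.prime.squarefree
  have hsqm : Squarefree (m : ℤ) := Int.squarefree_natCast.mpr hm.prime.squarefree
  have hsqlm : Squarefree ((l : ℤ) * m) := by
    have : Squarefree (l * m) :=
      Nat.squarefree_mul_iff.mpr ⟨(Nat.coprime_primes hl hm).mpr hlm_ne, hl.prime.squarefree, hm.prime.squarefree⟩
    exact_mod_cast Int.squarefree_natCast.mpr this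
  -- residue bookkeeping mod `m ≡ 5 (8)`: `2` is a non-residue, `l` a non-zero square
  have hm2ns : ¬ IsSquare (((2 : ℤ)) : ZMod m) := by
    intro h
    have h' : IsSquare (2 : ZMod m) := by exact_mod_cast h
    have := (ZMod.exists_sq_eq_two_iff hm2).mp h'
    omega
  have hlm0 : ((l : ℤ) : ZMod m) ≠ 0 := by
    rw [Ne, ZMod.intCast_zmod_eq_zero_iff_dvd]
    exact fun h => hlm_ne ((Nat.prime_dvd_prime_iff_eq hm hl).mp (by exact_mod_cast h)).symm
  obtain ⟨s, hs⟩ := hlm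
  have hs0 : s ≠ 0 := by rintro rfl; rw [mul_zero] at hs; exact hlm0 hs
  have hsN : ((l : ℕ) : ZMod m) = s * s := by exact_mod_cast hs
  have hl0N : ((l : ℕ) : ZMod m) ≠ 0 := by exact_mod_cast hlm0
  have h2l_ns : ¬ IsSquare (((2 * (l : ℤ)) : ℤ) : ZMod m) := by
    rintro ⟨r, hr⟩
    apply hm2ns
    refine ⟨r * s⁻¹, ?_⟩
    push_cast at hr ⊢
    rw [hsN] at hr
    field_simp
    linear_combination hr
  have h2ll_ns : ¬ IsSquare (((2 * (l : ℤ) ^ 2) : ℤ) : ZMod m) := by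
    rintro ⟨r, hr⟩
    apply hm2ns
    refine ⟨r * ((l : ℕ) : ZMod m)⁻¹, ?_⟩
    push_cast at hr ⊢
    field_simp
    linear_combination hr
  -- the four members
  have m1 : (1 : ℤ) ∈ twoIsogenySelmerGroup 0 B := one_mem_twoIsogenySelmerGroup 0 hB
  have ml : (l : ℤ) ∈ twoIsogenySelmerGroup 0 B := by
    rw [mem_twoIsogenySelmerGroup_iff hB]
    refine ⟨hsql, ⟨4 * l * (m : ℤ) ^ 2, by rw [hBdef]; ring⟩, ?_⟩
    rw [ediv_eq_of_mul_eq_left hl0 (d' := 4 * l * (m : ℤ) ^ 2) (by rw [hBdef]; ring), twoIsogenyQuartic_zero]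
    exact isLocallySoluble_l_class_R1 hl8 hm8 ⟨s, hs⟩ hml
  have mm : (m : ℤ) ∈ twoIsogenySelmerGroup 0 B := by
    rw [mem_twoIsogenySelmerGroup_iff hB]
    refine ⟨hsqm, ⟨4 * m * (l : ℤ) ^ 2, by rw [hBdef]; ring⟩, ?_⟩
    rw [ediv_eq_of_mul_eq_left hm0 (d' := 4 * m * (l : ℤ) ^ 2) (by rw [hBdef]; ring), twoIsogenyQuartic_zero]
    exact isLocallySoluble_m_class_R1 hl8 hm8 ⟨s, hs⟩ hml
  have mlm : ((l : ℤ) * m) ∈ twoIsogenySelmerGroup 0 B := by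
    obtain ⟨d₃, hd₃, c, hc0, hc⟩ := exists_mem_twoIsogenySelmerGroup_of_mul_mem hab ml mm
    have hsq₃ := squarefree_of_mem_twoIsogenySelmerGroup hd₃
    have h : (l : ℤ) * m * d₃ = (c * d₃) ^ 2 := by
      calc (l : ℤ) * m * d₃ = (c ^ 2 * d₃) * d₃ := by rw [← hc]
        _ = (c * d₃) ^ 2 := by ring
    rwa [eq_of_squarefree_of_mul_eq_sq hsqlm hsq₃ h]
  -- the exclusions: members are positive and odd
  have hexcl : ∀ d ∈ twoIsogenySelmerGroup 0 B, 0 < d ∧ ¬ (2 : ℤ) ∣ d := by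
    intro d hd
    rw [mem_twoIsogenySelmerGroup_iff hB] at hd
    obtain ⟨hsq, hdvd, hloc⟩ := hd
    have hd0 : d ≠ 0 := hsq.ne_zero
    have hmul : d * (B / d) = B := Int.mul_ediv_cancel' hdvd
    have hpos : 0 < d := by
      by_contra hle
      have hneg : d < 0 := lt_of_le_of_ne (not_lt.mp hle) hd0
      have hBd : B / d < 0 := by nlinarith
      exact not_isSoluble_real_twoIsogenyQuartic_of_neg hneg hBd le_rfl hloc.1
    refine ⟨hpos, fun h2d => ?_⟩
    obtain ⟨d₁, rfl⟩ := h2d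
    have hd₁0 : 0 < d₁ := by omega
    have hsq₁ : Squarefree d₁ := hsq.squarefree_of_dvd (dvd_mul_left d₁ 2)
    have hodd₁ : ¬ (2 : ℤ) ∣ d₁ := by
      rintro ⟨c, rfl⟩
      exact Int.prime_two.not_unit (isUnit_of_dvd_unit (dvd_refl _) (hsq 2 ⟨c, by ring⟩))
    have hdvd₁ : d₁ ∣ 4 * (l : ℤ) ^ 2 * (m : ℤ) ^ 2 := by
      have h2 : 2 * d₁ ∣ 2 * (2 * (l : ℤ) ^ 2 * (m : ℤ) ^ 2) := by
        convert hdvd using 1; rw [hBdef]; ring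
      exact ((mul_dvd_mul_iff_left two_ne_zero).mp h2).trans ⟨2, by ring⟩
    have hloc_m := hloc.2 m
    rcases eq_of_squarefree_dvd_R1 (l := l) (m := m) hlm_ne hd₁0 hsq₁ hodd₁ hdvd₁ with rfl | rfl | rfl | rfl
    · -- `d = 2`: `w² = 2u⁴ + m²(2l²) z⁴`
      have hBd : B / (2 * 1) = (m : ℤ) ^ 2 * (2 * (l : ℤ) ^ 2) :=
        ediv_eq_of_mul_eq_left (by norm_num) (by rw [hBdef]; ring)
      rw [hBd, mul_one, twoIsogenyQuartic_zero] at hloc_m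
      exact not_isSoluble_padic_diag_of_sq_mul hm2ns h2ll_ns hloc_m
    · -- `d = 2l`: `w² = 2l u⁴ + m²(2l) z⁴`
      have hBd : B / (2 * (l : ℤ)) = (m : ℤ) ^ 2 * (2 * (l : ℤ)) :=
        ediv_eq_of_mul_eq_left (mul_ne_zero two_ne_zero hl0) (by rw [hBdef]; ring)
      rw [hBd, twoIsogenyQuartic_zero] at hloc_m
      exact not_isSoluble_padic_diag_of_sq_mul h2l_ns h2l_ns hloc_m
    · -- `d = 2m`: `w² = m·2 u⁴ + m·(2l²) z⁴`, `2x⁴ + 2l² ≢ 0`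
      have hBd : B / (2 * (m : ℤ)) = (m : ℤ) * (2 * (l : ℤ) ^ 2) :=
        ediv_eq_of_mul_eq_left (mul_ne_zero two_ne_zero hm0) (by rw [hBdef]; ring)
      rw [hBd, show (2 * (m : ℤ)) = (m : ℤ) * 2 by ring, twoIsogenyQuartic_zero] at hloc_m
      refine not_isSoluble_padic_diag_of_dvd_both_of_forall (q := m) (d₁ := 2) (e₁ := 2 * (l : ℤ) ^ 2)
        (by intro h; have := Int.le_of_dvd (by norm_num) h; omega) (fun x hx => ?_) hloc_m
      have h2m : (2 : ZMod m) ≠ 0 := by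
        intro h0
        have : ((2 : ℕ) : ZMod m) = 0 := by exact_mod_cast h0
        rw [ZMod.natCast_eq_zero_iff] at this
        exact hm2 ((Nat.prime_dvd_prime_iff_eq hm Nat.prime_two).mp this)
      apply pow_four_ne_neg_sq_of_emod_eight hm8 hlm0 ⟨s, hs⟩ x
      push_cast at hx
      have : (2 : ZMod m) * (x ^ 4 + ((l : ℤ) : ZMod m) ^ 2) = 0 := by push_cast; linear_combination hx
      rcases mul_eq_zero.mp this with h | h
      · exact absurd h h2m
      · linear_combination h
    · -- `d = 2lm`: `w² = m·(2l) u⁴ + m·(2l) z⁴`, `2l(x⁴ + 1) ≢ 0`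
      have hBd : B / (2 * ((l : ℤ) * m)) = (m : ℤ) * (2 * (l : ℤ)) :=
        ediv_eq_of_mul_eq_left (mul_ne_zero two_ne_zero (mul_ne_zero hl0 hm0)) (by rw [hBdef]; ring)
      rw [hBd, show (2 * ((l : ℤ) * m)) = (m : ℤ) * (2 * (l : ℤ)) by ring, twoIsogenyQuartic_zero] at hloc_m
      refine not_isSoluble_padic_diag_of_dvd_both_of_forall (q := m) (d₁ := 2 * (l : ℤ)) (e₁ := 2 * (l : ℤ))
        (fun h => ?_) (fun x hx => ?_) hloc_m
      · have hmi : Prime (m : ℤ) := Nat.prime_iff_prime_int.mp hm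
        rcases hmi.dvd_or_dvd h with h2 | h2
        · have := Int.le_of_dvd (by norm_num) h2; omega
        · exact hlm_ne ((Nat.prime_dvd_prime_iff_eq hm hl).mp (by exact_mod_cast h2)).symm
      · have h2l0 : (2 * ((l : ℤ) : ZMod m)) ≠ 0 := by
          refine mul_ne_zero (fun h0 => ?_) hlm0
          have : ((2 : ℕ) : ZMod m) = 0 := by exact_mod_cast h0
          rw [ZMod.natCast_eq_zero_iff] at this
          exact hm2 ((Nat.prime_dvd_prime_iff_eq hm Nat.prime_two).mp this)
        apply pow_four_ne_neg_one_of_emod_eight hm8 x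
        push_cast at hx
        have : (2 * ((l : ℤ) : ZMod m)) * (x ^ 4 + 1) = 0 := by push_cast; linear_combination hx
        rcases mul_eq_zero.mp this with h | h
        · exact absurd h h2l0
        · linear_combination h
  -- assembly
  ext d
  simp only [Finset.mem_insert, Finset.mem_singleton]
  constructor
  · intro hd
    have hd' := hd
    rw [mem_twoIsogenySelmerGroup_iff hB] at hd'
    obtain ⟨hpos, hodd⟩ := hexcl d hd
    exact eq_of_squarefree_dvd_R1 (l := l) (m := m) hlm_ne hpos hd'.1 hodd hd'.2.1
  · rintro (rfl | rfl | rfl | rfl)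
    · exact m1
    · exact ml
    · exact mm
    · exact mlm

/-- **`dim S'(0, −l²m²) = 2` on R1** (`Sel^{(φ)}(E_{lm} → A_{lm}) = {1, l, m, lm}` has order `4`). [cite: SilvermanAEC2009, Prop. X.4.9] -/
theorem twoIsogenySelmerRank'_R1 (hl8 : l % 8 = 1) (hm8 : m % 8 = 5)
    (hlm : IsSquare ((l : ℤ) : ZMod m)) (hml : IsSquare ((m : ℤ) : ZMod l)) :
    twoIsogenySelmerRank' 0 (-(((l * m : ℕ) : ℤ)) ^ 2) = 2 := by
  have hl := hlp.out
  have hm := hmp.out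
  have hlm_ne : l ≠ m := by rintro rfl; omega
  have heq : twoIsogenySelmerRank' 0 (-(((l * m : ℕ) : ℤ)) ^ 2) =
      twoIsogenySelmerRank 0 (4 * (l : ℤ) ^ 2 * (m : ℤ) ^ 2) := by
    rw [twoIsogenySelmerRank', show (-2 * 0 : ℤ) = 0 by norm_num,
      show (0 : ℤ) ^ 2 - 4 * (-(((l * m : ℕ) : ℤ)) ^ 2) = 4 * (l : ℤ) ^ 2 * (m : ℤ) ^ 2 by push_cast; ring]
  rw [heq, twoIsogenySelmerRank, twoIsogenySelmerGroup'_R1 hl8 hm8 hlm hml]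
  have hl1 : (1 : ℤ) < l := by exact_mod_cast hl.one_lt
  have hm1 : (1 : ℤ) < m := by exact_mod_cast hm.one_lt
  have hne : (l : ℤ) ≠ m := by exact_mod_cast hlm_ne
  have h4 : (l : ℤ) < (l : ℤ) * m := by nlinarith
  have h5 : (m : ℤ) < (l : ℤ) * m := by nlinarith
  have key : ∀ N : ℤ, (l : ℤ) < N → (m : ℤ) < N → ({1, (l : ℤ), (m : ℤ), N} : Finset ℤ).card = 4 := by
    intro N hN1 hN2
    rw [Finset.card_insert_of_notMem (by simp only [Finset.mem_insert, Finset.mem_singleton]; omega),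
      Finset.card_insert_of_notMem (by simp only [Finset.mem_insert, Finset.mem_singleton]; omega),
      Finset.card_insert_of_notMem (by simp only [Finset.mem_singleton]; omega), Finset.card_singleton]
  rw [key _ h4 h5]
  exact Nat.log_pow Nat.one_lt_two 2

end R1'

end Summit.BirchSwinnertonDyer.PrintCf2.PartnerSha

end
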